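import Mathlib
import Summits.ValiantsHypothesis.ValiantsHypothesis.Theorems.BarrierLeverDefinableEquationsDifferentialClosureWitness

/-!
# Crux `BarrierLever.DefinableEquations` (stmt-8745) / `SingleSizeEquations` (stmt-8749) —
# sparsity wall, LEMMAS: lines in a zero set, killing a coordinate, and the two pieces of a
# polynomial along a splitting coordinate (differential closure III-a; val-np-p5 g8)

Pure algebra over `ℂ[c_μ : μ ∈ σ]` used by `…SparsityWall.lean`:

* §1 `iterate_pderiv_eval_eq_zero_of_line`, `iterate_pderiv_eval_line_eq_zero` — if `E` vanishes
  on the line `c + ℂ e_μ` then so does every `∂_μ^a E` (one-variable Taylor coefficients,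
  `GKSS2019.iterate_pderiv_eq_factorial_mul_coeff`); the pointwise core of Part I's
  `DifferentialClosure.iterate_pderiv_vanishes`.
* §2 `eval_killVar`, `killVar_monomial`, `coeff_killVar` — the substitution `c_μ := 0`
  (`aeval (fun ν => if ν = μ then 0 else X ν)`, no new definition): evaluation and coefficients.
* §3 the two PIECES of `E` along a coordinate `μ`: TOP `∂_μ^{deg_μ E} E` and BOTTOM
  `(∂_μ^{j} E)(c_μ := 0)` for the least exponent `j` of `c_μ` in `E`: their monomials shifted by
  `deg_μ E · e_μ` resp. `j e_μ` are disjoint sets of monomials of `E`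
  (`card_support_pieces_le`), both pieces are nonzero (`top_ne_zero`, `bottom_ne_zero`,
  characteristic `0`, via `DifferentialClosure.coeff_iterate_pderiv`), and a polynomial with two
  monomials has such a splitting coordinate (`exists_splitting_coordinate`).

No definitions, no named facts; standard axioms; nothing here bears on `VP ≠ VNP`.
-/

-- `Summit.ValiantsHypothesis.ValiantsHypothesis.…` repeats a component by the D-0017 layout
-- (single-conjunct summit), which the `dupNamespace` linter flags; the name is mandated.
set_option linter.dupNamespace false

noncomputable section

namespace Summit.ValiantsHypothesis.ValiantsHypothesis.Theorems.BarrierLeverDefinableEquations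

open MvPolynomial
open Literature.Computability.AlgebraicComplexity Literature.Barriers.ValiantsHypothesis
open scoped BigOperators

namespace SparsityWall

/-! ## §1 Lines in the zero set: all coordinate derivatives vanish along the whole line -/

/-- Pointwise form of the differential closure: if `E` vanishes on the line `c + ℂ e_μ` then
every `∂_μ^a E` vanishes at `c`. [folklore] -/
theorem iterate_pderiv_eval_eq_zero_of_line {σ : Type*} [DecidableEq σ] (E : MvPolynomial σ ℂ)
    (c : σ → ℂ) (μ : σ) (h : ∀ t : ℂ, eval (fun ν => c ν + if ν = μ then t else 0) E = 0)
    (a : ℕ) : eval c ((pderiv μ)^[a] E) = 0 := by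
  have h1 := GKSS2019.iterate_pderiv_eq_factorial_mul_coeff μ E a
  have h2 := fun t : ℂ => GKSS2019.eval_aeval_taylorVar μ E (C t)
  set T := aeval (fun i => Polynomial.C (X i) +
      if i = μ then (Polynomial.X : Polynomial (MvPolynomial σ ℂ)) else 0) E with hT
  -- evaluating the shifted polynomial at `c` is evaluating `E` on the line
  have hshift : ∀ t : ℂ, eval c (aeval (fun i => if i = μ then X i + C t else X i) E) = 0 := by
    intro t
    have hb : aeval (fun i : σ => if i = μ then X i + C t else (X i : MvPolynomial σ ℂ)) E =
        bind₁ (fun i => if i = μ then X i + C t else X i) E := rfl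
    rw [hb, show eval c (bind₁ _ E) = eval₂Hom (RingHom.id ℂ) c (bind₁ _ E) from rfl,
      eval₂Hom_bind₁, ← h t]
    show eval₂Hom (RingHom.id ℂ) _ E = eval₂Hom (RingHom.id ℂ) _ E
    congr 2
    funext ν
    split_ifs with hν
    · subst hν; simp
    · simp
  have hP : T.map (eval c) = 0 := by
    refine Polynomial.funext fun t => ?_
    rw [Polynomial.eval_zero, Polynomial.eval_map, show t = eval c (C t) by rw [eval_C],
      Polynomial.eval₂_at_apply, h2 t]
    exact hshift t
  have hcoeff : eval c (T.coeff a) = 0 := by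
    rw [← Polynomial.coeff_map, hP, Polynomial.coeff_zero]
  rw [h1, map_mul, hcoeff, mul_zero]

/-- … hence every `∂_μ^a E` vanishes on the whole line `c + ℂ e_μ` (the line through any of its
points in direction `e_μ` is the same line). [folklore] -/
theorem iterate_pderiv_eval_line_eq_zero {σ : Type*} [DecidableEq σ] (E : MvPolynomial σ ℂ)
    (c : σ → ℂ) (μ : σ) (h : ∀ t : ℂ, eval (fun ν => c ν + if ν = μ then t else 0) E = 0)
    (a : ℕ) (t : ℂ) : eval (fun ν => c ν + if ν = μ then t else 0) ((pderiv μ)^[a] E) = 0 := by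
  refine iterate_pderiv_eval_eq_zero_of_line E _ μ (fun t' => ?_) a
  have : (fun ν => (c ν + if ν = μ then t else 0) + if ν = μ then t' else 0) =
      fun ν => c ν + if ν = μ then t + t' else 0 := by
    funext ν; split_ifs <;> ring
  rw [this]
  exact h (t + t')

/-! ## §2 Killing one coordinate -/

/-- Evaluating `E(c_μ := 0)` is evaluating `E` at the point with its `μ`-coordinate zeroed.
[folklore] -/
theorem eval_killVar {σ : Type*} [DecidableEq σ] (E : MvPolynomial σ ℂ) (c : σ → ℂ) (μ : σ) :
    eval c (aeval (fun ν => if ν = μ then (0 : MvPolynomial σ ℂ) else X ν) E) =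
      eval (fun ν => if ν = μ then 0 else c ν) E := by
  have hb : aeval (fun ν : σ => if ν = μ then (0 : MvPolynomial σ ℂ) else X ν) E =
      bind₁ (fun ν => if ν = μ then 0 else X ν) E := rfl
  rw [hb, show eval c (bind₁ _ E) = eval₂Hom (RingHom.id ℂ) c (bind₁ _ E) from rfl, eval₂Hom_bind₁]
  show eval₂Hom (RingHom.id ℂ) _ E = eval₂Hom (RingHom.id ℂ) _ E
  congr 2
  funext ν
  split_ifs with hν <;> simp

/-- Killing `c_μ` on a monomial: unchanged if `μ` does not occur, zero otherwise. [folklore] -/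
theorem killVar_monomial {σ : Type*} [DecidableEq σ] (μ : σ) (s : σ →₀ ℕ) (a : ℂ) :
    aeval (fun ν => if ν = μ then (0 : MvPolynomial σ ℂ) else X ν) (monomial s a) =
      if s μ = 0 then monomial s a else 0 := by
  rw [aeval_monomial, ← C_eq_algebraMap]
  split_ifs with hs
  · rw [monomial_eq]
    congr 1
    refine Finsupp.prod_congr fun ν hν => ?_
    have : ν ≠ μ := fun h => (Finsupp.mem_support_iff.mp hν) (h ▸ hs)
    rw [if_neg this]
  · have hμ : μ ∈ s.support := Finsupp.mem_support_iff.mpr hs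
    rw [Finsupp.prod, Finset.prod_eq_zero hμ (by rw [if_pos rfl, zero_pow hs]), mul_zero]

/-- Coefficients after killing `c_μ`: those of the monomials free of `c_μ` survive. [folklore] -/
theorem coeff_killVar {σ : Type*} [DecidableEq σ] (E : MvPolynomial σ ℂ) (μ : σ) (m : σ →₀ ℕ) :
    coeff m (aeval (fun ν => if ν = μ then (0 : MvPolynomial σ ℂ) else X ν) E) =
      if m μ = 0 then coeff m E else 0 := by
  conv_lhs => rw [E.as_sum, map_sum, coeff_sum]
  simp only [killVar_monomial]
  split_ifs with hm
  · conv_rhs => rw [E.as_sum, coeff_sum]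
    refine Finset.sum_congr rfl fun s _ => ?_
    split_ifs with hs
    · rfl
    · rw [coeff_zero, coeff_monomial, if_neg]
      intro h; exact hs (h ▸ hm)
  · refine Finset.sum_eq_zero fun s _ => ?_
    split_ifs with hs
    · rw [coeff_monomial, if_neg]
      intro h; exact hm (h ▸ hs)
    · exact coeff_zero _

/-! ## §3 The two pieces of a polynomial along a coordinate -/

/-- Monomials of `∂_μ^j E` come from monomials of `E` by removing `j e_μ`. [folklore] -/
theorem add_single_mem_support_of_mem_support_iterate_pderiv {σ : Type*} (μ : σ)
    {E : MvPolynomial σ ℂ} {j : ℕ} {m : σ →₀ ℕ} (hm : m ∈ ((pderiv μ)^[j] E).support) :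
    m + Finsupp.single μ j ∈ E.support := by
  rw [mem_support_iff, DifferentialClosure.coeff_iterate_pderiv] at hm
  exact mem_support_iff.mpr (right_ne_zero_of_mul hm)

/-- Monomials of the TOP piece `∂_μ^{deg_μ E} E` are free of `c_μ`. [folklore] -/
theorem apply_eq_zero_of_mem_support_top {σ : Type*} (μ : σ) {E : MvPolynomial σ ℂ}
    {m : σ →₀ ℕ} (hm : m ∈ ((pderiv μ)^[degreeOf μ E] E).support) : m μ = 0 := by
  have h := monomial_le_degreeOf μ (add_single_mem_support_of_mem_support_iterate_pderiv μ hm)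
  simp only [Finsupp.coe_add, Pi.add_apply, Finsupp.single_eq_same] at h
  omega

/-- Monomials of the BOTTOM piece `(∂_μ^j E)(c_μ := 0)` are free of `c_μ` and come from monomials
of `E` with `μ`-exponent exactly `j`. [folklore] -/
theorem mem_support_bottom {σ : Type*} [DecidableEq σ] (μ : σ) {E : MvPolynomial σ ℂ} {j : ℕ}
    {m : σ →₀ ℕ} (hm : m ∈ (aeval (fun ν => if ν = μ then (0 : MvPolynomial σ ℂ) else X ν)
      ((pderiv μ)^[j] E)).support) :
    m μ = 0 ∧ m + Finsupp.single μ j ∈ E.support := by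
  rw [mem_support_iff, coeff_killVar] at hm
  split_ifs at hm with h0
  · exact ⟨h0, add_single_mem_support_of_mem_support_iterate_pderiv μ (mem_support_iff.mpr hm)⟩
  · exact absurd rfl hm

/-- **The two pieces together have at most as many monomials as `E`** (their monomials, shifted
back by `j_max e_μ` resp. `j_min e_μ`, are disjoint subsets of the monomials of `E` as soon as
`j_min < j_max = deg_μ E`). [folklore] -/
theorem card_support_pieces_le {σ : Type*} [DecidableEq σ] (μ : σ) (E : MvPolynomial σ ℂ)
    {j : ℕ} (hj : j < degreeOf μ E) :
    ((pderiv μ)^[degreeOf μ E] E).support.card +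
      (aeval (fun ν => if ν = μ then (0 : MvPolynomial σ ℂ) else X ν)
        ((pderiv μ)^[j] E)).support.card ≤ E.support.card := by
  set A := ((pderiv μ)^[degreeOf μ E] E).support.map
    (addRightEmbedding (Finsupp.single μ (degreeOf μ E))) with hA
  set B := (aeval (fun ν => if ν = μ then (0 : MvPolynomial σ ℂ) else X ν)
    ((pderiv μ)^[j] E)).support.map (addRightEmbedding (Finsupp.single μ j)) with hB
  have hAB : Disjoint A B := by
    rw [Finset.disjoint_left]
    intro x hxA hxB
    rw [hA, Finset.mem_map] at hxA
    rw [hB, Finset.mem_map] at hxB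
    obtain ⟨a, ha, rfl⟩ := hxA
    obtain ⟨b, hb, hab⟩ := hxB
    have ha0 := apply_eq_zero_of_mem_support_top μ ha
    have hb0 := (mem_support_bottom μ hb).1
    have := congrArg (fun x : σ →₀ ℕ => x μ) hab
    simp only [addRightEmbedding_apply, Finsupp.coe_add, Pi.add_apply, Finsupp.single_eq_same,
      ha0, hb0, zero_add] at this
    omega
  have hsub : A ∪ B ⊆ E.support := by
    intro x hx
    rcases Finset.mem_union.mp hx with hxA | hxB
    · rw [hA, Finset.mem_map] at hxA
      obtain ⟨a, ha, rfl⟩ := hxA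
      exact add_single_mem_support_of_mem_support_iterate_pderiv μ ha
    · rw [hB, Finset.mem_map] at hxB
      obtain ⟨b, hb, rfl⟩ := hxB
      exact (mem_support_bottom μ hb).2
  calc ((pderiv μ)^[degreeOf μ E] E).support.card +
        (aeval (fun ν => if ν = μ then (0 : MvPolynomial σ ℂ) else X ν)
          ((pderiv μ)^[j] E)).support.card
      = A.card + B.card := by rw [hA, hB, Finset.card_map, Finset.card_map]
    _ = (A ∪ B).card := (Finset.card_union_of_disjoint hAB).symm
    _ ≤ E.support.card := Finset.card_le_card hsub

/-- The top piece is nonzero (`E ≠ 0`, characteristic `0`). [folklore] -/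
theorem top_ne_zero {σ : Type*} (μ : σ) {E : MvPolynomial σ ℂ} (hE : E ≠ 0) :
    (pderiv μ)^[degreeOf μ E] E ≠ 0 := by
  classical
  have hne : E.support.Nonempty := support_nonempty.mpr hE
  obtain ⟨s₀, hs₀, hmax⟩ := Finset.exists_max_image E.support (fun m => m μ) hne
  refine DifferentialClosure.iterate_pderiv_ne_zero μ hs₀ ?_
  rw [degreeOf_eq_sup]
  exact Finset.sup_le fun m hm => hmax m hm

/-- The bottom piece at the least `μ`-exponent `j` occurring in `E` is nonzero. [folklore] -/
theorem bottom_ne_zero {σ : Type*} [DecidableEq σ] (μ : σ) {E : MvPolynomial σ ℂ}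
    {m₁ : σ →₀ ℕ} (hm₁ : m₁ ∈ E.support) (hmin : ∀ m ∈ E.support, m₁ μ ≤ m μ) :
    aeval (fun ν => if ν = μ then (0 : MvPolynomial σ ℂ) else X ν)
      ((pderiv μ)^[m₁ μ] E) ≠ 0 := by
  intro h
  have hc := congrArg (coeff (m₁ - Finsupp.single μ (m₁ μ))) h
  rw [coeff_killVar, coeff_zero, if_pos (by simp), DifferentialClosure.coeff_iterate_pderiv,
    tsub_add_cancel_of_le (by
      intro ν; by_cases hν : ν = μ
      · subst hν; simp
      · rw [Finsupp.single_apply, if_neg (fun h => hν h.symm)]; exact Nat.zero_le _)] at hc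
  refine mul_ne_zero ?_ (mem_support_iff.mp hm₁) hc
  have hμ : (m₁ - Finsupp.single μ (m₁ μ)) μ + m₁ μ = m₁ μ := by simp
  rw [hμ]
  exact_mod_cast (Nat.descFactorial_self (m₁ μ) ▸ Nat.factorial_ne_zero (m₁ μ) :
    (m₁ μ).descFactorial (m₁ μ) ≠ 0)

/-- A polynomial with at least two monomials has a coordinate `μ` in which two of its monomials
have different exponents; the least exponent is then below `deg_μ`. [folklore] -/
theorem exists_splitting_coordinate {σ : Type*} {E : MvPolynomial σ ℂ} (h2 : 2 ≤ E.support.card) :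
    ∃ (μ : σ) (m₁ : σ →₀ ℕ), m₁ ∈ E.support ∧ (∀ m ∈ E.support, m₁ μ ≤ m μ) ∧
      m₁ μ < degreeOf μ E := by
  classical
  obtain ⟨a, ha, b, hb, hab⟩ := Finset.one_lt_card.mp h2
  obtain ⟨μ, hμ⟩ : ∃ μ, a μ ≠ b μ := by
    by_contra hno; push Not at hno; exact hab (Finsupp.ext hno)
  have hne : E.support.Nonempty := ⟨a, ha⟩
  obtain ⟨m₁, hm₁, hmin⟩ := Finset.exists_min_image E.support (fun m => m μ) hne
  refine ⟨μ, m₁, hm₁, hmin, ?_⟩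
  have ha' := monomial_le_degreeOf μ ha
  have hb' := monomial_le_degreeOf μ hb
  have h1 := hmin a ha
  have h2 := hmin b hb
  omega

end SparsityWall

end Summit.ValiantsHypothesis.ValiantsHypothesis.Theorems.BarrierLeverDefinableEquations
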